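import Literature.NumberTheory.DiophantineGeometry.LebesgueNagellSixtyFour
import Mathlib.NumberTheory.Multiplicity
import Mathlib.RingTheory.PrincipalIdealDomain
import HarnessLib

/-!
# The prime-square edge of crux `StarGO2` (item stmt-BirchSwinnertonDyer-24444) — arithmetic lemmas

Line `star` of crux E1M `DepletedLambdaLawAtTwoMod` (stmt-BirchSwinnertonDyer-20341) is down to the two
research children `StarOptB` (24445) and `StarGO2` (24444). Planner bsd-rank2-p2 GEN 29 isolated the
PRIME-SQUARE EDGE of `StarGO2` (memo `HOME/p2/g29/GO2-via-UBD.md` §8a, file `HOME/p2/g29/PrimeSq.lean`): at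
conductor `N = p²` with `p ≡ ±3 (mod 8)` the depleted Eisenstein ray is ramified, so `StarGO2` there is
EQUIVALENT to «no ÉTALE rational `2`-torsion at conductor `p²`, `p ≡ ±3 (mod 8)»`. The proof is Setzer's
descent on the `2`-torsion normal form `y² = x³ + Ax² + Bx`, run with `p ∣ c₄` (additive reduction) in
place of `p ∤ c₄`; this file collects the elementary Diophantine lemmas it uses (§1 of
`Literature/NumberTheory/EllipticCurves/PrimeConductorTwoTorsionProofs.lean`, where they are `private`,
adapted; plus three small parity / size facts). Consumers:
`Theorems/EisensteinDepletionAtTwoStarGO2PrimeSqDiophantine.lean` (the descent `PrimeSq.core`) and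
`Theorems/EisensteinDepletionAtTwoStarGO2PrimeSqEtaleTwoTorsion.lean` (the curve statement).

HONEST FRAMING: elementary arithmetic toward ONE edge of an OPEN crux (`StarGO2`, generalized Ogg at the
prime `2`); neither `StarGO2` nor E1M is proved here; nothing reads an analytic rank; BSD is not proved
by any of this.

References: [Setzer1975] B. Setzer, *Elliptic curves of prime conductor*, J. London Math. Soc. (2) 10
(1975) 367–378, §2; [Cohn1993] J. H. E. Cohn, *The Diophantine equation x² + C = yⁿ*, Acta Arith. 65
(1993) (the case `C = 64`, tree `LebesgueNagellSixtyFour.lean`).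
-/

set_option linter.dupNamespace false
set_option autoImplicit false

namespace Summit.BirchSwinnertonDyer.BirchSwinnertonDyer.Theorems.DepletionAtTwo

namespace PrimeSq

/-! ## §1 Arithmetic lemmas (adapted from `Literature/.../PrimeConductorTwoTorsionProofs.lean` §1) -/

/-- `pˡ = 17` for a prime `p` forces `p = 17` (and `l = 1`). [folklore] -/
theorem eq_seventeen_of_pow_eq {N l : ℕ} (h : (N : ℤ) ^ l = 17) : N = 17 ∧ l = 1 := by
  -- adapted from Literature/NumberTheory/EllipticCurves/PrimeConductorTwoTorsionProofs.lean
  have h' : N ^ l = 17 := by exact_mod_cast h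
  exact (Nat.Prime.pow_eq_iff (by norm_num)).mp h'

/-- `pˡ ≠ 15` for a prime `p`. [folklore] -/
theorem pow_ne_fifteen {N l : ℕ} (hN : N.Prime) (h : (N : ℤ) ^ l = 15) : False := by
  -- adapted from Literature/NumberTheory/EllipticCurves/PrimeConductorTwoTorsionProofs.lean
  have h' : N ^ l = 15 := by exact_mod_cast h
  have h3 : 3 ∣ N := Nat.prime_three.dvd_of_dvd_pow (n := l) (by rw [h']; norm_num)
  have h5 : 5 ∣ N := Nat.prime_five.dvd_of_dvd_pow (n := l) (by rw [h']; norm_num)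
  have e3 := (Nat.prime_dvd_prime_iff_eq Nat.prime_three hN).mp h3
  have e5 := (Nat.prime_dvd_prime_iff_eq Nat.prime_five hN).mp h5
  omega

/-- A divisor (up to sign) of a prime power `pⁿ` is `±pʲ`. [folklore] -/
theorem eq_pow_or_neg_pow_of_dvd {N : ℕ} (hN : N.Prime) {b : ℤ} {n : ℕ}
    (h : b ∣ (N : ℤ) ^ n) : ∃ j : ℕ, b = (N : ℤ) ^ j ∨ b = -((N : ℤ) ^ j) := by
  -- adapted from Literature/NumberTheory/EllipticCurves/PrimeConductorTwoTorsionProofs.lean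
  have h1 : b.natAbs ∣ N ^ n := by
    have := Int.natAbs_dvd_natAbs.mpr h
    simpa [Int.natAbs_pow] using this
  obtain ⟨j, -, hj⟩ := (Nat.dvd_prime_pow hN).mp h1
  refine ⟨j, ?_⟩
  have := Int.natAbs_eq_iff.mp hj
  push_cast at this
  exact this

/-- **Key divisibility step.** If `x·y = K·pˡ` for a prime `p` that does not divide both `x` and
`y`, then `pˡ` divides one of the two factors and the cofactor equation holds. [folklore] -/
theorem exists_cofactor {p : ℤ} (hp : Prime p) {x y K : ℤ} {l : ℕ}
    (h : x * y = K * p ^ l) (hxy : ¬ (p ∣ x ∧ p ∣ y)) :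
    ∃ m : ℤ, (x = p ^ l * m ∧ m * y = K) ∨ (y = p ^ l * m ∧ x * m = K) := by
  -- adapted from Literature/NumberTheory/EllipticCurves/PrimeConductorTwoTorsionProofs.lean
  rcases Nat.eq_zero_or_pos l with hl | _
  · subst hl
    exact ⟨x, Or.inl ⟨by ring, by simpa using h⟩⟩
  have hdvd : p ^ l ∣ x * y := ⟨K, by rw [h]; ring⟩
  have hp0 : p ^ l ≠ 0 := pow_ne_zero _ hp.ne_zero
  by_cases hx : p ∣ x
  · have hy : ¬ p ∣ y := fun hy => hxy ⟨hx, hy⟩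
    obtain ⟨m, hm⟩ := hp.pow_dvd_of_dvd_mul_right l hy hdvd
    refine ⟨m, Or.inl ⟨hm, mul_left_cancel₀ hp0 ?_⟩⟩
    linear_combination h - y * hm
  · obtain ⟨m, hm⟩ := hp.pow_dvd_of_dvd_mul_left l hx hdvd
    refine ⟨m, Or.inr ⟨hm, mul_left_cancel₀ hp0 ?_⟩⟩
    linear_combination h - x * hm

/-- `(A − 8)(A + 8) = ±pˡ` with `p` an odd prime forces `p = 17`, `A = ±9`. [folklore] -/
theorem sq_sub_sixtyfour {N : ℕ} (hN : N.Prime) (hN2 : N ≠ 2) {A : ℤ} {l : ℕ}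
    (h : (A - 8) * (A + 8) = (N : ℤ) ^ l ∨ (A - 8) * (A + 8) = -((N : ℤ) ^ l)) :
    N = 17 ∧ (A = 9 ∨ A = -9) := by
  -- adapted from Literature/NumberTheory/EllipticCurves/PrimeConductorTwoTorsionProofs.lean
  have hp : Prime (N : ℤ) := Nat.prime_iff_prime_int.mp hN
  have hpos : (0 : ℤ) < (N : ℤ) ^ l := pow_pos (by exact_mod_cast hN.pos) l
  have hxy : ¬ ((N : ℤ) ∣ A - 8 ∧ (N : ℤ) ∣ A + 8) := by
    rintro ⟨h1, h2⟩
    have h16 : (N : ℤ) ∣ 2 ^ 4 := by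
      have := dvd_sub h2 h1
      ring_nf at this ⊢
      exact this
    have h16' : N ∣ 2 ^ 4 := by exact_mod_cast h16
    exact hN2 ((Nat.prime_dvd_prime_iff_eq hN Nat.prime_two).mp (hN.dvd_of_dvd_pow h16'))
  obtain ⟨K, hK, hKval⟩ : ∃ K : ℤ, (A - 8) * (A + 8) = K * (N : ℤ) ^ l ∧ (K = 1 ∨ K = -1) := by
    rcases h with h | h
    · exact ⟨1, by rw [h]; ring, Or.inl rfl⟩
    · exact ⟨-1, by rw [h]; ring, Or.inr rfl⟩
  obtain ⟨m, hm⟩ := exists_cofactor hp hK hxy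
  generalize hM : (N : ℤ) ^ l = M at hm hpos
  have key : M = 17 ∧ (A = 9 ∨ A = -9) ∨ M = 15 := by
    rcases hm with ⟨h1, h2⟩ | ⟨h1, h2⟩
    · rcases hKval with rfl | rfl
      · rcases Int.eq_one_or_neg_one_of_mul_eq_one' h2 with ⟨rfl, h3⟩ | ⟨rfl, h3⟩ <;> omega
      · rcases Int.eq_one_or_neg_one_of_mul_eq_neg_one' h2 with ⟨rfl, h3⟩ | ⟨rfl, h3⟩ <;> omega
    · rcases hKval with rfl | rfl
      · rcases Int.eq_one_or_neg_one_of_mul_eq_one' h2 with ⟨h3, rfl⟩ | ⟨h3, rfl⟩ <;> omega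
      · rcases Int.eq_one_or_neg_one_of_mul_eq_neg_one' h2 with ⟨h3, rfl⟩ | ⟨h3, rfl⟩ <;> omega
  rcases key with ⟨hM17, hA⟩ | hM15
  · exact ⟨(eq_seventeen_of_pow_eq (hM.trans hM17)).1, hA⟩
  · exact (pow_ne_fifteen hN (hM.trans hM15)).elim

/-- `(A − 1)(A + 1) = ±64pˡ` with `p` an odd prime forces `p = 17`, `A = ±33`. [folklore] -/
theorem sq_sub_one {N : ℕ} (hN : N.Prime) (hN2 : N ≠ 2) {A : ℤ} {l : ℕ}
    (h : (A - 1) * (A + 1) = 64 * (N : ℤ) ^ l ∨ (A - 1) * (A + 1) = -(64 * (N : ℤ) ^ l)) :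
    N = 17 ∧ (A = 33 ∨ A = -33) := by
  -- adapted from Literature/NumberTheory/EllipticCurves/PrimeConductorTwoTorsionProofs.lean
  have hp : Prime (N : ℤ) := Nat.prime_iff_prime_int.mp hN
  have hpos : (0 : ℤ) < (N : ℤ) ^ l := pow_pos (by exact_mod_cast hN.pos) l
  have hodd : ((N : ℤ) ^ l) % 2 = 1 :=
    Int.odd_iff.mp ((Int.odd_coe_nat N).mpr (hN.odd_of_ne_two hN2)).pow
  have hxy : ¬ ((N : ℤ) ∣ A - 1 ∧ (N : ℤ) ∣ A + 1) := by
    rintro ⟨h1, h2⟩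
    have h2' : (N : ℤ) ∣ 2 ^ 1 := by
      have := dvd_sub h2 h1
      ring_nf at this ⊢
      exact this
    have h2'' : N ∣ 2 ^ 1 := by exact_mod_cast h2'
    exact hN2 ((Nat.prime_dvd_prime_iff_eq hN Nat.prime_two).mp (hN.dvd_of_dvd_pow h2''))
  obtain ⟨K, hK, hKval⟩ :
      ∃ K : ℤ, (A - 1) * (A + 1) = K * (N : ℤ) ^ l ∧ (K = 64 ∨ K = -64) := by
    rcases h with h | h
    · exact ⟨64, by rw [h], Or.inl rfl⟩
    · exact ⟨-64, by rw [h]; ring, Or.inr rfl⟩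
  obtain ⟨m, hm⟩ := exists_cofactor hp hK hxy
  have hmdvd : m ∣ 64 := by
    have hmK : m ∣ K := by
      rcases hm with ⟨-, h2⟩ | ⟨-, h2⟩
      · exact Dvd.intro _ h2
      · exact Dvd.intro_left _ h2
    rcases hKval with rfl | rfl
    · exact hmK
    · exact (dvd_neg.mp hmK)
  have hm1 : m ≤ 64 := Int.le_of_dvd (by norm_num) hmdvd
  have hm2 : -64 ≤ m := by have := Int.le_of_dvd (by norm_num) (neg_dvd.mpr hmdvd); omega
  generalize hM : (N : ℤ) ^ l = M at hm hpos hodd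
  have key : M = 17 ∧ (A = 33 ∨ A = -33) ∨ M = 15 := by
    rcases hm with ⟨h1, h2⟩ | ⟨h1, h2⟩
    · have h3 : m * (M * m + 2) = K := by linear_combination h2 - m * h1
      rcases hKval with rfl | rfl <;> interval_cases m <;> omega
    · have h3 : m * (M * m - 2) = K := by linear_combination h2 - m * h1
      rcases hKval with rfl | rfl <;> interval_cases m <;> omega
  rcases key with ⟨hM17, hA⟩ | hM15
  · exact ⟨(eq_seventeen_of_pow_eq (hM.trans hM17)).1, hA⟩
  · exact (pow_ne_fifteen hN (hM.trans hM15)).elim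

/-- A divisor of `±pᵐ` prime to `p` is `±1`: if `p ∤ b` and `b·c = ±pᵐ` then `b = ±1`. [folklore] -/
theorem eq_one_or_neg_one_of_mul_eq {p : ℤ} (hp : Prime p) {b c : ℤ} {m : ℕ} (hb : ¬ p ∣ b)
    (h : b * c = p ^ m ∨ b * c = -(p ^ m)) : b = 1 ∨ b = -1 := by
  have hcop : IsCoprime (p ^ m) b := ((Prime.coprime_iff_not_dvd hp).mpr hb).pow_left
  have hd : b ∣ p ^ m * 1 := by
    rw [mul_one]
    rcases h with h | h
    · exact ⟨c, h.symm⟩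
    · exact ⟨-c, by linear_combination h⟩
  exact Int.isUnit_iff.mp (isUnit_of_dvd_one (hcop.symm.dvd_of_dvd_mul_left hd))

/-- Cancelling `p³`: if `p³·X = ±pⁿ` (`p` prime) then `n = m + 3` and `X = ±pᵐ`. [folklore] -/
theorem of_pow_three_mul {p : ℕ} (hp : p.Prime) {X : ℤ} {n : ℕ}
    (h : (p : ℤ) ^ 3 * X = (p : ℤ) ^ n ∨ (p : ℤ) ^ 3 * X = -((p : ℤ) ^ n)) :
    ∃ m : ℕ, n = m + 3 ∧ (X = (p : ℤ) ^ m ∨ X = -((p : ℤ) ^ m)) := by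
  have hp0 : (p : ℤ) ^ 3 ≠ 0 := pow_ne_zero _ (by exact_mod_cast hp.ne_zero)
  have h3n : 3 ≤ n := by
    have hdvd : (p : ℤ) ^ 3 ∣ (p : ℤ) ^ n := by
      rcases h with h | h
      · exact ⟨X, h.symm⟩
      · exact ⟨-X, by linear_combination h⟩
    have hdvd' : p ^ 3 ∣ p ^ n := by exact_mod_cast hdvd
    exact (Nat.pow_dvd_pow_iff_le_right hp.one_lt).mp hdvd'
  refine ⟨n - 3, by omega, ?_⟩
  have hpow : (p : ℤ) ^ n = (p : ℤ) ^ 3 * (p : ℤ) ^ (n - 3) := by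
    rw [← pow_add]; congr 1; omega
  rcases h with h | h
  · left; exact mul_left_cancel₀ hp0 (by rw [h, hpow])
  · right; exact mul_left_cancel₀ hp0 (by rw [h, hpow]; ring)

/-- The square of an odd integer is `≡ 1 (mod 8)`. [folklore] -/
theorem sq_emod_eight_of_odd {A : ℤ} (hA : Odd A) : A ^ 2 % 8 = 1 := by
  obtain ⟨m, rfl⟩ := hA
  have h : (2 * m + 1) ^ 2 = 4 * (m * (m + 1)) + 1 := by ring
  obtain ⟨e, he⟩ := (Int.even_mul_succ_self m).two_dvd
  rw [h, he]
  omega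

/-- `63`, `65`, `−63`, `−65` are not squares. [folklore] -/
theorem sq_ne_sixtyfour_pm_one {A : ℤ} (h : A ^ 2 = 63 ∨ A ^ 2 = 65 ∨ A ^ 2 = -63 ∨ A ^ 2 = -65) :
    False := by
  have hb1 : A ≤ 9 := by rcases h with h | h | h | h <;> nlinarith [sq_nonneg A]
  have hb2 : -9 ≤ A := by rcases h with h | h | h | h <;> nlinarith [sq_nonneg A]
  interval_cases A <;> rcases h with h | h | h | h <;> norm_num at h

end PrimeSq

end Summit.BirchSwinnertonDyer.BirchSwinnertonDyer.Theorems.DepletionAtTwo
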